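import Summits.PneNP.PneNP.Theorems.OracleRefusal.Negative.StaInvVar

/-!
# `OracleRefusal` (stmt-PneNP-1864) — negative side, II: Semantic inversion, part 3 (§B.5): the LETTERS `0̲ = λxy.x`, `1̲ = λxy.y` — every derivation at a BoolLike type has
results exactly in `⟦0⟧` / `⟦1⟧` and a junk context (`bool_runs`), and realises every `0•a` / `1•a` (`bool_exists`).
-/

namespace Summit.PneNP.PneNP.Theorems.OracleRefusal.Negative

open Literature.Computability.ImplicitComplexity
open Literature.Computability.ImplicitComplexity.URel
open Literature.Computability.ImplicitComplexity.STA (Deriv Ctx Term LinTy SoftTy encWord encBit tyS tyB tyF mpxRen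
  liftRen)

/-! ## §B.5 The letters: `⟦0⟧`, `⟦1⟧` exactly, junk on the context -/

/-- Runs of `λy.y` (the inner abstraction of `1 = λxy.y`): result `![a]‾ ⅋ a`, the whole context junk.
[cite: LaurentTortoraDeFalco2006, Def. 12] -/
theorem inner0_runs : {d : ℕ} → {Γ : Ctx} → {M : Term} → {σ : SoftTy} → (D : Deriv d Γ M σ) →
    M = .lam (.var 0) → σ.bangs = 0 → ArrLike σ.lin →
      ∀ {ρ : Val} {x : Point}, (ρ, x) ∈ D.interp → (∃ a, x = (bang1 a).dual.par a) ∧ ∀ s, SlotIn Junk Γ ρ s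
  | _, _, _, _, .ax _, hM, _, _, _, _, _ => by cases hM
  | _, _, _, _, .weak j A h hj hΓ', hM, hσ, hA, ρ, x, hr => by
      obtain ⟨ρ', p, hm, he⟩ := hr
      obtain ⟨hx, hJ⟩ := inner0_runs h hM hσ hA hm
      simp only [Prod.mk.injEq] at he
      obtain ⟨rfl, rfl⟩ := he
      subst hΓ'
      refine ⟨hx, fun s => ?_⟩
      by_cases hsj : s = j
      · subst hsj; exact SlotIn.update_self_junk s A
      · exact (hJ s).update_ne hsj _ _
  | _, _, _, _, .lam (k := k) (B := B) (Γ := Γ) h, hM, _, hA, ρ, x, hr => by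
      cases hM
      obtain rfl : k = 0 := hA k B _ rfl
      obtain ⟨ρ₁, p, V, hm, h0, he⟩ := hr
      simp only [Prod.mk.injEq] at he
      obtain ⟨rfl, rfl⟩ := he
      obtain ⟨-, hW, hJ⟩ := var_runs h rfl rfl hm
      obtain ⟨V', hV', hVm⟩ := hW ⟨0, B⟩ rfl
      rw [h0] at hV'
      cases hV'
      refine ⟨⟨p, by rw [show V = bang1 p from hVm]⟩, fun s => (hJ (s + 1) (by omega)).unshift⟩
  | _, _, _, _, .app _ _ _, hM, _, _, _, _, _ => by cases hM
  | _, _, _, _, .mpx S j h hS hj hΓ' hM', hM, hσ, hA, ρ, x, hr => by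
      rw [hM] at hM'
      obtain ⟨M₁, e₁, h₁⟩ := rename_eq_lam hM'.symm
      obtain ⟨i₁, e₂, hi₁⟩ := rename_eq_var h₁
      obtain rfl : i₁ = 0 := liftRen_eq_zero hi₁
      rw [e₂] at e₁
      obtain ⟨ρ', p, hm, he⟩ := hr
      obtain ⟨hx, hJ⟩ := inner0_runs h e₁ hσ hA hm
      simp only [Prod.mk.injEq] at he
      obtain ⟨rfl, rfl⟩ := he
      subst hΓ'
      refine ⟨hx, fun s => ?_⟩
      by_cases hsS : s ∈ S
      · exact SlotIn.mpx_of_mem hsS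
      · by_cases hsj : s = j
        · subst hsj; exact SlotIn.mpx_self boxable_junk hS hj fun s' _ => hJ s'
        · exact (hJ s).mpx_of_not_mem hsS hsj
  | _, _, _, _, .sp _ _, _, hσ, _, _, _, _ => by simp at hσ
  | _, _, _, _, .allI h hΔ, hM, _, hA, ρ, x, hr => by
      obtain ⟨hx, hJ⟩ := inner0_runs h hM rfl (fun k B C hp => hA k B C hp) hr
      rw [hΔ] at hJ
      exact ⟨hx, fun s => (hJ s).of_shift⟩
  | _, _, _, _, .allE _ h, hM, _, hA, _, _, hr => inner0_runs h hM rfl (fun k B C hp => hA.of_substp k B C hp) hr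
  | _, _, _, _, .sum _ _, hM, _, _, _, _, _ => by cases hM

/-- Existence of runs of `λy.y` with any axiom label. [cite: LaurentTortoraDeFalco2006, Def. 12] -/
theorem inner0_exists : {d : ℕ} → {Γ : Ctx} → {M : Term} → {σ : SoftTy} → (D : Deriv d Γ M σ) →
    M = .lam (.var 0) → σ.bangs = 0 → ArrLike σ.lin → ∀ a : Point, ∃ ρ : Val, (ρ, (bang1 a).dual.par a) ∈ D.interp
  | _, _, _, _, .ax _, hM, _, _, _ => by cases hM
  | _, _, _, _, .weak j A h hj hΓ', hM, hσ, hA, a => by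
      obtain ⟨ρ, hρ⟩ := inner0_exists h hM hσ hA a
      exact ⟨_, ρ, _, hρ, rfl⟩
  | _, _, _, _, .lam (k := k) (B := B) h, hM, _, hA, a => by
      cases hM
      obtain rfl : k = 0 := hA k B _ rfl
      obtain ⟨ρ₁, hm⟩ := var_exists h rfl rfl a
      obtain ⟨-, hW, -⟩ := var_runs h rfl rfl hm
      obtain ⟨V', hV', hVm⟩ := hW ⟨0, B⟩ rfl
      exact ⟨_, ρ₁, a, bang1 a, hm, by rw [hV', show V' = bang1 a from hVm], rfl⟩
  | _, _, _, _, .app _ _ _, hM, _, _, _ => by cases hM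
  | _, _, _, _, .mpx S j h hS hj hΓ' hM', hM, hσ, hA, a => by
      rw [hM] at hM'
      obtain ⟨M₁, e₁, h₁⟩ := rename_eq_lam hM'.symm
      obtain ⟨i₁, e₂, hi₁⟩ := rename_eq_var h₁
      obtain rfl : i₁ = 0 := liftRen_eq_zero hi₁
      rw [e₂] at e₁
      obtain ⟨ρ, hρ⟩ := inner0_exists h e₁ hσ hA a
      exact ⟨_, ρ, _, hρ, rfl⟩
  | _, _, _, _, .sp _ _, _, hσ, _, _ => by simp at hσ
  | _, _, _, _, .allI h _, hM, _, hA, a => inner0_exists h hM rfl (fun k B C hp => hA k B C hp) a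
  | _, _, _, _, .allE _ h, hM, _, hA, a => inner0_exists h hM rfl (fun k B C hp => hA.of_substp k B C hp) a
  | _, _, _, _, .sum _ _, hM, _, _, _ => by cases hM

/-- Runs of `λy.x` (the inner abstraction of `0 = λxy.x`, `x` the variable `i` outside): result `![]‾ ⅋ a` with the
slot of `x` wrapped around `![a]` and junk elsewhere. [cite: LaurentTortoraDeFalco2006, Def. 12] -/
theorem inner1_runs : {d : ℕ} → {Γ : Ctx} → {M : Term} → {σ : SoftTy} → (D : Deriv d Γ M σ) → {i : ℕ} →
    M = .lam (.var (i + 1)) → σ.bangs = 0 → ArrLike σ.lin →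
      ∀ {ρ : Val} {x : Point}, (ρ, x) ∈ D.interp → ∃ a, x = bang0.dual.par a ∧ VarSpec Γ i ρ a
  | _, _, _, _, .ax _, _, hM, _, _, _, _, _ => by cases hM
  | _, _, _, _, .weak j A h hj hΓ', i, hM, hσ, hA, ρ, x, hr => by
      obtain ⟨ρ', p, hm, he⟩ := hr
      obtain ⟨a, hx, hV⟩ := inner1_runs h hM hσ hA hm
      simp only [Prod.mk.injEq] at he
      obtain ⟨rfl, rfl⟩ := he
      subst hΓ'
      exact ⟨a, hx, hV.weak hj A⟩
  | _, _, _, _, .lam (k := k) (B := B) (Γ := Γ) h, i, hM, _, hA, ρ, x, hr => by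
      cases hM
      obtain rfl : k = 0 := hA k B _ rfl
      obtain ⟨ρ₁, p, V, hm, h0, he⟩ := hr
      simp only [Prod.mk.injEq] at he
      obtain ⟨rfl, rfl⟩ := he
      have hV := var_runs h rfl rfl hm
      obtain ⟨J, hJ', hJm⟩ := hV.2.2 0 (by omega) ⟨0, B⟩ rfl
      rw [h0] at hJ'
      cases hJ'
      exact ⟨p, by rw [show V = bang0 from hJm], hV.unshift⟩
  | _, _, _, _, .app _ _ _, _, hM, _, _, _, _, _ => by cases hM
  | _, _, _, _, .mpx S j h hS hj hΓ' hM', i, hM, hσ, hA, ρ, x, hr => by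
      rw [hM] at hM'
      obtain ⟨M₁, e₁, h₁⟩ := rename_eq_lam hM'.symm
      obtain ⟨i₁, e₂, hi₁⟩ := rename_eq_var h₁
      obtain ⟨i', rfl, hi'⟩ := liftRen_eq_succ hi₁
      rw [e₂] at e₁
      obtain ⟨ρ', p, hm, he⟩ := hr
      obtain ⟨a, hx, hV⟩ := inner1_runs h e₁ hσ hA hm
      simp only [Prod.mk.injEq] at he
      obtain ⟨rfl, rfl⟩ := he
      subst hΓ'
      rw [← hi']
      exact ⟨a, hx, hV.mpx hS hj⟩
  | _, _, _, _, .sp _ _, _, _, hσ, _, _, _, _ => by simp at hσ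
  | _, _, _, _, .allI h hΔ, i, hM, _, hA, ρ, x, hr => by
      obtain ⟨a, hx, hV⟩ := inner1_runs h hM rfl (fun k B C hp => hA k B C hp) hr
      rw [hΔ] at hV
      exact ⟨a, hx, hV.of_shift⟩
  | _, _, _, _, .allE _ h, _, hM, _, hA, _, _, hr => inner1_runs h hM rfl (fun k B C hp => hA.of_substp k B C hp) hr
  | _, _, _, _, .sum _ _, _, hM, _, _, _, _, _ => by cases hM

/-- Existence of runs of `λy.x` with any axiom label. [cite: LaurentTortoraDeFalco2006, Def. 12] -/
theorem inner1_exists : {d : ℕ} → {Γ : Ctx} → {M : Term} → {σ : SoftTy} → (D : Deriv d Γ M σ) → {i : ℕ} →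
    M = .lam (.var (i + 1)) → σ.bangs = 0 → ArrLike σ.lin → ∀ a : Point, ∃ ρ : Val, (ρ, bang0.dual.par a) ∈ D.interp
  | _, _, _, _, .ax _, _, hM, _, _, _ => by cases hM
  | _, _, _, _, .weak j A h hj hΓ', i, hM, hσ, hA, a => by
      obtain ⟨ρ, hρ⟩ := inner1_exists h hM hσ hA a
      exact ⟨_, ρ, _, hρ, rfl⟩
  | _, _, _, _, .lam (k := k) (B := B) h, i, hM, _, hA, a => by
      cases hM
      obtain rfl : k = 0 := hA k B _ rfl
      obtain ⟨ρ₁, hm⟩ := var_exists h rfl rfl a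
      have hV := var_runs h rfl rfl hm
      obtain ⟨J, hJ', hJm⟩ := hV.2.2 0 (by omega) ⟨0, B⟩ rfl
      exact ⟨_, ρ₁, a, bang0, hm, by rw [hJ', show J = bang0 from hJm], rfl⟩
  | _, _, _, _, .app _ _ _, _, hM, _, _, _ => by cases hM
  | _, _, _, _, .mpx S j h hS hj hΓ' hM', i, hM, hσ, hA, a => by
      rw [hM] at hM'
      obtain ⟨M₁, e₁, h₁⟩ := rename_eq_lam hM'.symm
      obtain ⟨i₁, e₂, hi₁⟩ := rename_eq_var h₁
      obtain ⟨i', rfl, -⟩ := liftRen_eq_succ hi₁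
      rw [e₂] at e₁
      obtain ⟨ρ, hρ⟩ := inner1_exists h e₁ hσ hA a
      exact ⟨_, ρ, _, hρ, rfl⟩
  | _, _, _, _, .sp _ _, _, _, hσ, _, _ => by simp at hσ
  | _, _, _, _, .allI h _, _, hM, _, hA, a => inner1_exists h hM rfl (fun k B C hp => hA k B C hp) a
  | _, _, _, _, .allE _ h, _, hM, _, hA, a => inner1_exists h hM rfl (fun k B C hp => hA.of_substp k B C hp) a
  | _, _, _, _, .sum _ _, _, hM, _, _, _ => by cases hM

/-- **Runs of a letter.** Every run of every derivation of `Γ ⊢ b̲ : T` (`T` linear and `BoolLike`, e.g. `B` or a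
type variable) has its result in the letter's clique `⟦0⟧`/`⟦1⟧` and a junk context.
[cite: LaurentTortoraDeFalco2006, Def. 12] -/
theorem bool_runs : {d : ℕ} → {Γ : Ctx} → {M : Term} → {σ : SoftTy} → (D : Deriv d Γ M σ) → {b : Bool} →
    M = encBit b → σ.bangs = 0 → BoolLike σ.lin →
      ∀ {ρ : Val} {x : Point}, (ρ, x) ∈ D.interp → x ∈ bitClique b ∧ ∀ s, SlotIn Junk Γ ρ s
  | _, _, _, _, .ax _, b, hM, _, _, _, _, _ => by cases b <;> cases hM
  | _, _, _, _, .weak j A h hj hΓ', b, hM, hσ, hB, ρ, x, hr => by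
      obtain ⟨ρ', p, hm, he⟩ := hr
      obtain ⟨hx, hJ⟩ := bool_runs h hM hσ hB hm
      simp only [Prod.mk.injEq] at he
      obtain ⟨rfl, rfl⟩ := he
      subst hΓ'
      refine ⟨hx, fun s => ?_⟩
      by_cases hsj : s = j
      · subst hsj; exact SlotIn.update_self_junk s A
      · exact (hJ s).update_ne hsj _ _
  | _, _, _, _, .lam (k := k) (B := B) (A := C) (Γ := Γ) h, b, hM, _, hB, ρ, x, hr => by
      obtain ⟨rfl, hC⟩ := hB k B C rfl
      obtain ⟨ρ₁, p, V, hm, h0, he⟩ := hr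
      simp only [Prod.mk.injEq] at he
      obtain ⟨rfl, rfl⟩ := he
      cases b
      · -- `0 = λxy.x`
        simp only [STA.encBit, STA.zero, Term.lam.injEq] at hM
        obtain ⟨a, rfl, hV⟩ := inner1_runs (i := 0) h hM rfl hC hm
        obtain ⟨V', hV', hVm⟩ := hV.2.1 ⟨0, B⟩ rfl
        rw [h0] at hV'
        cases hV'
        exact ⟨⟨a, by rw [show V = bang1 a from hVm]; rfl⟩, fun s => (hV.2.2 (s + 1) (by omega)).unshift⟩
      · -- `1 = λxy.y`
        simp only [STA.encBit, STA.one, Term.lam.injEq] at hM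
        obtain ⟨⟨a, rfl⟩, hJ⟩ := inner0_runs h hM rfl hC hm
        obtain ⟨V', hV', hVm⟩ := hJ 0 ⟨0, B⟩ rfl
        rw [h0] at hV'
        cases hV'
        exact ⟨⟨a, by rw [show V = bang0 from hVm]; rfl⟩, fun s => (hJ (s + 1)).unshift⟩
  | _, _, _, _, .app _ _ _, b, hM, _, _, _, _, _ => by cases b <;> cases hM
  | _, _, _, _, .mpx S j h hS hj hΓ' hM', b, hM, hσ, hB, ρ, x, hr => by
      rw [hM] at hM'
      have e := rename_eq_encBit hM'.symm
      obtain ⟨ρ', p, hm, he⟩ := hr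
      obtain ⟨hx, hJ⟩ := bool_runs h e hσ hB hm
      simp only [Prod.mk.injEq] at he
      obtain ⟨rfl, rfl⟩ := he
      subst hΓ'
      refine ⟨hx, fun s => ?_⟩
      by_cases hsS : s ∈ S
      · exact SlotIn.mpx_of_mem hsS
      · by_cases hsj : s = j
        · subst hsj; exact SlotIn.mpx_self boxable_junk hS hj fun s' _ => hJ s'
        · exact (hJ s).mpx_of_not_mem hsS hsj
  | _, _, _, _, .sp _ _, _, _, hσ, _, _, _, _ => by simp at hσ
  | _, _, _, _, .allI h hΔ, b, hM, _, hB, ρ, x, hr => by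
      obtain ⟨hx, hJ⟩ := bool_runs h hM rfl (fun k B C hp => hB k B C hp) hr
      rw [hΔ] at hJ
      exact ⟨hx, fun s => (hJ s).of_shift⟩
  | _, _, _, _, .allE _ h, _, hM, _, hB, _, _, hr => bool_runs h hM rfl (fun k B C hp => hB.of_substp k B C hp) hr
  | _, _, _, _, .sum _ _, b, hM, _, _, _, _, _ => by cases b <;> cases hM

/-- **Existence of runs of a letter** with any axiom label: `0•a ∈ ⟦0̲⟧`, `1•a ∈ ⟦1̲⟧` for every derivation.
[cite: LaurentTortoraDeFalco2006, Def. 12] -/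
theorem bool_exists : {d : ℕ} → {Γ : Ctx} → {M : Term} → {σ : SoftTy} → (D : Deriv d Γ M σ) → {b : Bool} →
    M = encBit b → σ.bangs = 0 → BoolLike σ.lin → ∀ a : Point, ∃ ρ : Val, (ρ, bitPtAt b a) ∈ D.interp
  | _, _, _, _, .ax _, b, hM, _, _, _ => by cases b <;> cases hM
  | _, _, _, _, .weak j A h hj hΓ', b, hM, hσ, hB, a => by
      obtain ⟨ρ, hρ⟩ := bool_exists h hM hσ hB a
      exact ⟨_, ρ, _, hρ, rfl⟩
  | _, _, _, _, .lam (k := k) (B := B) (A := C) h, b, hM, _, hB, a => by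
      obtain ⟨rfl, hC⟩ := hB k B C rfl
      cases b
      · simp only [STA.encBit, STA.zero, Term.lam.injEq] at hM
        obtain ⟨ρ₁, hm⟩ := inner1_exists (i := 0) h hM rfl hC a
        obtain ⟨a', ha', hV⟩ := inner1_runs (i := 0) h hM rfl hC hm
        obtain ⟨-, rfl⟩ := Point.par_inj.1 ha'
        obtain ⟨V', hV', hVm⟩ := hV.2.1 ⟨0, B⟩ rfl
        exact ⟨_, ρ₁, _, bang1 a, hm, by rw [hV', show V' = bang1 a from hVm], rfl⟩
      · simp only [STA.encBit, STA.one, Term.lam.injEq] at hM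
        obtain ⟨ρ₁, hm⟩ := inner0_exists h hM rfl hC a
        obtain ⟨-, hJ⟩ := inner0_runs h hM rfl hC hm
        obtain ⟨V', hV', hVm⟩ := hJ 0 ⟨0, B⟩ rfl
        exact ⟨_, ρ₁, _, bang0, hm, by rw [hV', show V' = bang0 from hVm], rfl⟩
  | _, _, _, _, .app _ _ _, b, hM, _, _, _ => by cases b <;> cases hM
  | _, _, _, _, .mpx S j h hS hj hΓ' hM', b, hM, hσ, hB, a => by
      rw [hM] at hM'
      obtain ⟨ρ, hρ⟩ := bool_exists h (rename_eq_encBit hM'.symm) hσ hB a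
      exact ⟨_, ρ, _, hρ, rfl⟩
  | _, _, _, _, .sp _ _, _, _, hσ, _, _ => by simp at hσ
  | _, _, _, _, .allI h _, _, hM, _, hB, a => bool_exists h hM rfl (fun k B C hp => hB k B C hp) a
  | _, _, _, _, .allE _ h, _, hM, _, hB, a => bool_exists h hM rfl (fun k B C hp => hB.of_substp k B C hp) a
  | _, _, _, _, .sum _ _, b, hM, _, _, _ => by cases b <;> cases hM

end Summit.PneNP.PneNP.Theorems.OracleRefusal.Negative
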